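import Summits.Ventures.CertifiedManyBodySolver.Theorems.TcThermcert1QbpGibbsDerivative
import Mathlib
import HarnessLib

/-!
# Quantum belief propagation, part 6: localising the conjugation (two Hamiltonians, one perturbation)

Helper file (theorems only, model-free) for stub B (`stub_farCutCurrent_of_clustering`) of the line
`gauge_qbp_far_seam` (cruxes `TcThermcert1.ThermalStiffnessCeilingU8b8_le_7o44` / `…U8b10_le_1o8`,
route `hubbard-tc-thermcert-1`).  Capel–Moscolari–Teufel–Wessel localise the QBP conjugation `η₁` of
`e^{-β(H+V)} = η₁ e^{-βH} η₁ᴴ` by a conditional expectation (Thm. 14, `η̃`).  The line localises instead by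
RESTRICTING THE DYNAMICS: `Ẽ` is the QBP conjugation for the pair `(H', V)` with `H'` the Hamiltonian
restricted to a collar of the support of `V`; then `Ẽ` lies in every subalgebra containing `H'` and `V`
(part 3), and the two ordered exponentials differ by what Lieb–Robinson allows.  This file is the
model-free glue of parts 1–3 for that step: given Hermitian `H`, `H'`, `V`, `β ≥ 0`, an integrable weight
`f` with the Duhamel-kernel identity, and a UNIFORM-in-`s ∈ [0,1]` bound
`‖τ_t^{H+sV}(V) - τ_t^{H'+sV}(V)‖ ≤ ε` for `|t| ≤ T`, there are `E`, `Ẽ` with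
`e^{-β(H+V)} = E e^{-βH} Eᴴ`, `‖E‖, ‖Ẽ‖ ≤ e^{(β/2)‖f‖₁‖V‖}`,
`‖E - Ẽ‖ ≤ (β/2)(ε‖f‖₁ + 2‖V‖ ∫_{|t|>T}|f|) e^{β‖f‖₁‖V‖}`, `E ∈ S` whenever `H, V ∈ S` and
`Ẽ ∈ S'` whenever `H', V ∈ S'` (`S`, `S'` subalgebras — in the line: the `U(1)×U(1)` commutant for
sector preservation, and the even CAR algebra of the collar for commutation with the far current).
[cite: CapelEtAl2023, Proposition 6 and Theorem 14 (proof, Step 1); arXiv:2310.09182]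
-/

noncomputable section

open Real Complex Set Filter MeasureTheory
open scoped Topology ComplexConjugate

namespace Summit.Ventures.CertifiedManyBodySolver.Theorems.TcThermcert1.GaugeQbpFarSeam

open Literature.MathematicalPhysics.QuantumLattice
open Matrix
open scoped Matrix.Norms.L2Operator

variable {n : Type*} [Fintype n] [DecidableEq n]

/-- The QBP generators of two Hamiltonians sharing the perturbation `V` are uniformly close when the two
Heisenberg evolutions of `V` are close on `|t| ≤ T`:
`‖X_s - Y_s‖ ≤ (β/2)(ε ‖f‖₁ + 2‖V‖ ∫_{|t|>T} |f|)` for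
`X_s = -(β/2) ∫ f(t) τ_t^{H+sV}(V) dt`, `Y_s` the same for `H'`. [cite: CapelEtAl2023, proof of Theorem 14] -/
theorem norm_qbpGenerator_sub_le {H H' V : Matrix n n ℂ} (hH : H.IsHermitian) (hH' : H'.IsHermitian)
    (hV : V.IsHermitian) {β : ℝ} (hβ : 0 ≤ β) {f : ℝ → ℝ} (hf : Integrable f) {T ε : ℝ} (hε0 : 0 ≤ ε) (s : ℝ)
    (hε : ∀ t : ℝ, |t| ≤ T →
      ‖heisenbergEvolution (H + (s : ℂ) • V) t V - heisenbergEvolution (H' + (s : ℂ) • V) t V‖ ≤ ε) :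
    ‖-(((β / 2 : ℝ) : ℂ) • ∫ t, (f t : ℂ) • heisenbergEvolution (H + (s : ℂ) • V) t V) -
        -(((β / 2 : ℝ) : ℂ) • ∫ t, (f t : ℂ) • heisenbergEvolution (H' + (s : ℂ) • V) t V)‖ ≤
      β / 2 * (ε * (∫ t, |f t|) + 2 * ‖V‖ * ∫ t in {t : ℝ | T < |t|}, |f t|) := by
  have hK : (H + (s : ℂ) • V).IsHermitian := isHermitian_add_real_smul hH hV s
  have hK' : (H' + (s : ℂ) • V).IsHermitian := isHermitian_add_real_smul hH' hV s
  have h := norm_weightedGenerator_sub_le hK hK' hf V hε0 hε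
  rw [show -(((β / 2 : ℝ) : ℂ) • ∫ t, (f t : ℂ) • heisenbergEvolution (H + (s : ℂ) • V) t V) -
        -(((β / 2 : ℝ) : ℂ) • ∫ t, (f t : ℂ) • heisenbergEvolution (H' + (s : ℂ) • V) t V) =
      -(((β / 2 : ℝ) : ℂ) • ((∫ t, (f t : ℂ) • heisenbergEvolution (H + (s : ℂ) • V) t V) -
        ∫ t, (f t : ℂ) • heisenbergEvolution (H' + (s : ℂ) • V) t V)) by rw [smul_sub]; abel,
    norm_neg, norm_smul, Complex.norm_real, Real.norm_eq_abs, abs_of_nonneg (by positivity : (0 : ℝ) ≤ β / 2)]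
  exact mul_le_mul_of_nonneg_left h (by positivity)

/-- **Localised QBP conjugation pair (model-free form of CMTW Thm 14, Step 1).**  For Hermitian `H`, `H'`, `V`,
`β ≥ 0`, an integrable real weight `f` with the Duhamel-kernel identity, and a uniform-in-`s ∈ [0,1]` bound
`‖τ_t^{H+sV}(V) - τ_t^{H'+sV}(V)‖ ≤ ε` (`|t| ≤ T`), the QBP conjugations `E` (for `H, V`) and `Ẽ` (for `H', V`)
satisfy: `e^{-β(H+V)} = E e^{-βH} Eᴴ`; `‖E‖, ‖Ẽ‖ ≤ e^{(β/2)‖f‖₁‖V‖}`;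
`‖E - Ẽ‖ ≤ (β/2)(ε‖f‖₁ + 2‖V‖∫_{|t|>T}|f|) e^{β‖f‖₁‖V‖}`; `E` lies in every subalgebra containing `H` and `V`,
`Ẽ` in every subalgebra containing `H'` and `V`. [cite: CapelEtAl2023, Proposition 6, Theorem 14; arXiv:2310.09182] -/
theorem exists_qbp_conjugation_pair {H H' V : Matrix n n ℂ} (hH : H.IsHermitian) (hH' : H'.IsHermitian)
    (hV : V.IsHermitian) {β : ℝ} (hβ : 0 ≤ β) {f : ℝ → ℝ} (hf : Integrable f)
    (hfK : ∀ x y : ℝ, (∫ t : ℝ, Complex.exp ((t : ℂ) * ((y : ℂ) - (x : ℂ)) * I) * (f t : ℂ)) *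
      (((Real.exp (-(β * x)) + Real.exp (-(β * y)) : ℝ)) : ℂ) = 2 * (duhamelKernel β x y : ℂ))
    {T ε : ℝ} (hε0 : 0 ≤ ε)
    (hε : ∀ s ∈ Icc (0:ℝ) 1, ∀ t : ℝ, |t| ≤ T →
      ‖heisenbergEvolution (H + (s : ℂ) • V) t V - heisenbergEvolution (H' + (s : ℂ) • V) t V‖ ≤ ε) :
    ∃ E E' : Matrix n n ℂ,
      gibbsWeight β (H + V) = E * gibbsWeight β H * Eᴴ ∧
      ‖E‖ ≤ Real.exp (β / 2 * ((∫ t, |f t|) * ‖V‖)) ∧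
      ‖E'‖ ≤ Real.exp (β / 2 * ((∫ t, |f t|) * ‖V‖)) ∧
      ‖E - E'‖ ≤ β / 2 * (ε * (∫ t, |f t|) + 2 * ‖V‖ * ∫ t in {t : ℝ | T < |t|}, |f t|) *
        Real.exp (β * ((∫ t, |f t|) * ‖V‖)) ∧
      (∀ S : Subalgebra ℂ (Matrix n n ℂ), H ∈ S → V ∈ S → E ∈ S) ∧
      (∀ S : Subalgebra ℂ (Matrix n n ℂ), H' ∈ S → V ∈ S → E' ∈ S) := by
  obtain ⟨η, hη0, hηd, hηn, hηE, hηS⟩ := exists_qbp_conjugation hH hV hβ hf hfK 1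
  obtain ⟨θ, hθ0, hθd, hθn, -, hθS⟩ := exists_qbp_conjugation hH' hV hβ hf hfK 1
  have h1 : (1 : ℝ) ∈ Icc (0 : ℝ) 1 := ⟨zero_le_one, le_rfl⟩
  -- generator bounds
  set M : ℝ := β / 2 * ((∫ t, |f t|) * ‖V‖) with hM
  have hXM : ∀ s : ℝ, ‖-(((β / 2 : ℝ) : ℂ) • ∫ t, (f t : ℂ) • heisenbergEvolution (H + (s : ℂ) • V) t V)‖ ≤ M :=
    fun s => norm_qbpCoeff_le (norm_weightedGenerator_le (isHermitian_add_real_smul hH hV s) f V) hβ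
  have hYM : ∀ s : ℝ, ‖-(((β / 2 : ℝ) : ℂ) • ∫ t, (f t : ℂ) • heisenbergEvolution (H' + (s : ℂ) • V) t V)‖ ≤ M :=
    fun s => norm_qbpCoeff_le (norm_weightedGenerator_le (isHermitian_add_real_smul hH' hV s) f V) hβ
  set δ : ℝ := β / 2 * (ε * (∫ t, |f t|) + 2 * ‖V‖ * ∫ t in {t : ℝ | T < |t|}, |f t|) with hδ
  have hXY : ∀ s ∈ Icc (0 : ℝ) 1,
      ‖-(((β / 2 : ℝ) : ℂ) • ∫ t, (f t : ℂ) • heisenbergEvolution (H + (s : ℂ) • V) t V) -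
        -(((β / 2 : ℝ) : ℂ) • ∫ t, (f t : ℂ) • heisenbergEvolution (H' + (s : ℂ) • V) t V)‖ ≤ δ :=
    fun s hs => norm_qbpGenerator_sub_le hH hH' hV hβ hf hε0 s (hε s hs)
  have hdiff := norm_orderedExp_sub_le hXM hYM hXY hη0 hηd hθ0 hθd 1 h1
  refine ⟨η 1, θ 1, ?_, ?_, ?_, ?_, fun S hHS hVS => hηS S hHS hVS 1 h1, fun S hHS hVS => hθS S hHS hVS 1 h1⟩
  · simpa using hηE 1 h1
  · simpa [hM] using hηn 1 h1
  · simpa [hM] using hθn 1 h1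
  · calc ‖η 1 - θ 1‖ ≤ δ * 1 * Real.exp (2 * M * 1) := hdiff
      _ = δ * Real.exp (β * ((∫ t, |f t|) * ‖V‖)) := by rw [mul_one, mul_one, hM]; ring_nf

end Summit.Ventures.CertifiedManyBodySolver.Theorems.TcThermcert1.GaugeQbpFarSeam

end
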